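import Mathlib
import HarnessLib
import HarnessLib.Audit
import Summits.CriticalPhenomena.Statement
import HarnessLib.Audit.Status.Attr

/-!
Route: HyperoctahedralRP

DORMANT since 2026-08-25T04:34:16Z (reconciler: no traction for 7.4 d (last activity item-evidence-added at 2026-08-17T19:00:39Z); parked, not closed — `ledger route dormant route-CriticalPhenomena-HyperoctahedralRP --off` to reactivate) — unstaffed, not closed; items shared with open routes are served there. `ledger route dormant <id> --off` reactivates.

Route HyperoctahedralRP (idea card hyperoctahedral-rp-rigidity). It suffices to show X_HRP := (A) ∧
(B) ∧ (C) ∧ (D) ∧ (E):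
(A) HRP₂ RIGIDITY [pure harmonic analysis, the new mechanism]: every continuous positive kernel K on
ℝ³∖{0}, homogeneous
of degree −2Δ with 1/2 ≤ Δ ≤ 1, which is invariant AND reflection positive (finite sums Σ c_a c_b
K(p_a − θ_n p_b)
≥ 0 over points p_a of the open half-space ⟨p,n⟩ > 0) with respect to the NINE lattice mirrors n ∈
{e_i, e_i ± e_j}
(the B₃ = hyperoctahedral mirror arrangement: coordinate planes x_i = 0 and diagonal planes x_i =
±x_j), is O(3)-invariant;
(B) given (A): every normalised (S = 0 off NonCoincident), non-degenerate, translation-invariant,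
scale-covariant pointwise scaling
limit S of the critical Ising correlators criticalCorr 3 is O(3)-invariant for all n
(IsRotationInvariant S) — the nine reflection
positivities of the n.n. model (FILS 1978) survive the limit and feed (A) at n = 2, an n-point
OS-continuation argument above; (C)
such a limit exists: ∃ ρ > 0 on (0,1], Δ > 0, S with HasPointwiseScalingLimit (criticalCorr 3) ρ S,
S = 0 off NonCoincident,
IsNondegenerateTwoPoint S, IsTranslationInvariant S, IsScaleCovariant Δ S — NO rotation clause
(isotropy is OUTPUT of this route,
not input); (D) every normalised, non-degenerate, Euclidean-invariant, scale-covariant pointwise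
scaling limit of criticalCorr
3 is inversion covariant with the same Δ (the inversion upgrade (U) of route IsingEuclidUpgrade,
RE-TYPED with the NonCoincident
normalisation demanded by Theorems/IsingEuclidUpgradeRefutations.lean); (E) every non-degenerate
pointwise scaling limit of criticalCorr
3 has U₄ ≢ 0 (shared item stmt-CriticalPhenomena-0636).  X_HRP → Ising3DConformalLimit in one
screen: (C) gives ρ, Δ, S; (B)
applied to (A) gives IsRotationInvariant S, hence IsEuclideanInvariant S; (D) gives
IsInversionCovariant Δ S; IsMoebiusCovariant
Δ S := Euclidean ∧ scale ∧ inversion (ConformalCovariance.lean); (E) gives HasNontrivialU4 S.  Lean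
(one line, elaborated rc
0 in the planner's Sketch.lean together with a term proof of the assembly): Assembly := HRP2Rigidity
→ LimitRotationInvariant
→ ExistsScaleCovariantLimit → InversionUpgradeNormalised → IsingEuclidUpgradeR4NonGaussian →
Ising3DConformalLimit, over
Literature.Probability.LatticeModels.{CorrFamily, HasPointwiseScalingLimit, criticalCorr,
NonCoincident, IsNondegenerateTwoPoint,
IsTranslationInvariant, IsRotationInvariant, IsEuclideanInvariant, IsScaleCovariant,
IsInversionCovariant, HasNontrivialU4},
EuclideanSpace.single, Submodule.reflection (ℝ ∙ n)ᗮ, inner ℝ, LinearIsometryEquiv (all `lean search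
--decl`-verified /
elaborated).

Rationale: WHY THIS LINE. Clause (ii) of Ising3DConformalLimit asks for O(3) ⊂ Möbius; on ℤ³ rotation
invariance of the critical limit
is only POSTULATED (DuminilCopinICM2022 §8.1 p.25) and every proved engine is planar (discrete
holomorphicity, arXiv:2012.11672;
LiouvilleRigidity). The n.n. Ising measure is reflection positive not only in the 3 coordinate
mirror families but in the 6
DIAGONAL site-planes x_i = ±x_j (FrohlichEtAl1978 §3 Thm 3.1; in tree the proved lemma
isingMeasure_univ_free_reflectionPositive
covers any involutive graph automorphism, e.g. the swap x₁↔x₂, and messager_miracleSole_diag_holds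
already exploits diagonal
reflections). RP in direction n is a ONE-variable analytic constraint on a homogeneous kernel: s ↦
K̂(√s·n + q) is Stieltjes for
q ⊥ n (Widder–Bernstein/BCR Thm 4.2.8, PDF p.96; one-directional Källén–Lehmann as in
arXiv:1912.07973 §5, arXiv:2404.05700
§3). In Glimm–Jaffe Thm 6.2.4 (PDF pp.95–96) the forward-cone support of the spectral measure USES
rotation invariance; here we
invert the logic: nine Stieltjes structures + homogeneity should FORCE isotropy. Imported area:
harmonic analysis on *-semigroups
(BergChristensenRessel1984), Stieltjes/Nevanlinna functions (SchillingSongVondracek2012), separate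
analyticity / one-dimensional
holomorphic extension (JarnickiPflug2011; KytmanovMyslivets2015 §3.4), Liouville on the affine
quadric. No RG, no conformal maps. New
objects: none beyond the nine-mirror RP predicate (definition requests filed).  PLANNER'S EVIDENCE
FOR (A) (NOTES.md): (i) the three
coordinate mirrors are provably insufficient (card: K₁, K₂; nine-mirror-algebra-test data) — their
loophole is a singularity of
K̂ across the planes {k_i = 0}: at a generic k ∈ {k₁ = 0} only e₂, e₃ among the three normals are
non-orthogonal to k and they
do not span. For the nine B₃ normals, at EVERY k ≠ 0 the non-orthogonal normals span ℝ³ (a plane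
through 0 contains ≤ 4 of the
nine, two planes ≤ 8 < 9), so separate Stieltjes-analyticity along spanning lines + the cross
theorem should give real-analyticity
of K̂ on ℝ³∖0 (LOCAL step). (ii) GLOBAL step at Δ = 1/2 (a = 1): if no pencil carries spacelike
spectral mass then C(q̂)
≤ C(n_j) on each mirror circle; the B₃ incidences (e₁+e₂ ∈ e₃^⊥, e₃ ∈ (e₁−e₂)^⊥) force equality,
equality
forces C constant along great circles, and sweeping circles through n_j over n_j^⊥ covers S²: C ≡
const. Same incidence argument
with reversed inequalities as a → 0⁺. (iii) finite spherical-harmonic content fails even ONE mirror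
(null-cone singularity of
order > 1 vs the Nevanlinna bound); hrp-null-cone-root-splitting proves the local two-mirror
polynomial case. What is open: analytic
continuation of the angular profile across the de Sitter real forms Q ∩ (n_j^⊥ ⊕ iℝn_j) of the
complex quadric for 1/2 < a <
1 with growth ≤ |Z|^{2(1−a)} (then polynomial ⇒ constant).  RANKED CRUXES. r2 HRP2Rigidity (A):
hardest-new and most informative;
refutable independently of the Ising model. r3 LimitRotationInvariant (B): the n-point upgrade given
(A) (nine-direction OS continuation
of S_n; alternative engine: rotations-are-boosts-modular). r4 ExistsScaleCovariantLimit (C):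
existence/scale covariance without
rotations (shared difficulty of every route; rp-cannot-fix-the-scale-log-periodic shows two-point RP
axiomatics cannot give it). r5
InversionUpgradeNormalised (D): Polyakov's upgrade, Ising-specific, correctly typed. r6 = 0636 (E).
Support: TwoPointKernelOfLimit
(glue: the limit kernel meets the hypotheses of (A); Δ ∈ [1/2,1] by scalingDimension_mem_Icc_holds,
continuity by MMS + homogeneity),
TwoPointLimitIsotropic (= A∘glue, the two-point milestone = rotational half of item 0634 in
continuum form), CriticalCorrNineMirrorRP
(lattice input, from isingMeasure_univ_free_reflectionPositive + hasBoxLimit_isingCorr_plus_holds).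
KILL CRITERIA. One anisotropic
continuous positive homogeneous (1/2 ≤ Δ ≤ 1) nine-mirror-RP kernel refutes (A) and closes the route
(and becomes a barrier entry
'lattice RP + scaling ⇏ isotropy'); cheapest searches: positive continuous mixtures
∫(kᵀAk)^{−a}dμ(A) whose branch points
smear into cuts, certified CAD on O_h forms of degree 10–12 (nine-mirror-algebra-test T1).
Refutation of (B) with (A) standing
(anisotropic higher S_n with round S₂ compatible with nine-direction OS positivity + scale
covariance) pivots the n-point step to the
modular engine. (C),(D),(E) are shared with IsingEuclidUpgrade/IsingCFTData; their refutation kills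
the conjunct or all routes alike.
NOT DECOMPOSED YET. (A) into LOCAL (real-analyticity via cross theorem) + GLOBAL (continuation
across the nine de Sitter forms /
Liouville on the quadric) — the natural first glued split once a prover confirms the local step; the
n-point OS machinery behind
(B); continuity/tightness inputs for (C); definition requests: Stieltjes function, mirror-RP kernel
predicate.

Novelty: NOVELTY (searched: card author's lit vsearch / crossref / galaxy --star all sweeps documented on the
card; novelty audit refuter-novelty-audit-CriticalPhenomena-Ising3DConformalLimit-1-0 graded the
card new-mechanism on 2026-08-15 after re-reading FILS I/II and arXiv:1912.07973, arXiv:2404.05700,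
arXiv:2012.11672; this planner 2026-08-15: `lit galaxy search "reflection positivity implies
rotation invariance" --star all` 0 hits, `lit vsearch` on separate analyticity →
KytmanovMyslivets2015 §3.4 (one-dimensional holomorphic extension property, Stout/Agranovskii) and
the cross-theorem monograph JarnickiPflug2011, `lit read` GlimmJaffe1987 Thm 6.2.4 PDF pp.95–96 and
BergChristensenRessel1984 Thm 4.2.8 p.96, §4.4.1–4.4.7 pp.111–113; `lit search` local/OpenAlex
unavailable this session (searchd reset / HTTP 429), recorded in NOTES.md).
Nearest prior art: (i) FrohlichEtAl1978 §3 Thm 3.1 and FILS II — reflection positivity in DIAGONAL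
site-planes, used only for chessboard/infrared bounds; (ii) arXiv:1912.07973 §5 and arXiv:2404.05700
§3 — the ONE-directional spectral (Källén–Lehmann/Stieltjes) representation of the critical
two-point function along e₁, used for monotonicity/gradient regularity; (iii) GlimmJaffe1987 Thm
6.2.4 — Lehmann representation where forward-cone spectral support is DERIVED FROM Euclidean
invariance; (iv) physics lore Cardy1996 §3 (lattice anisotropy = irrelevant spin-4 operator),
DuminilCopinICM2022 §8.1 (rotation invariance on ℤ³ postulated, open); (v) in-hous  [refs: 1912.07973, 2404.05700, 2012.11672, KytmanovMyslivets2015, JarnickiPflug2011, GlimmJaffe1987, BergChristensenRessel1984, FrohlichEtAl1978, Cardy1996, DuminilCopinICM2022]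

Barriers (technique_class: hyperoctahedral-rp-rigidity, multi-mirror-rp): technique_class: hyperoctahedral-rp-rigidity, multi-mirror-rp
- Literature.Barriers.CriticalPhenomena.ScaleCovarianceNotMoebius: its witness is already
O(3)-invariant and concerns the inversion; the B₃ → O(3) step (A)/(B) has reflection positivity in
nine directions among its hypotheses, outside the barrier's class EuclideanScaleUpgrade; crux (D)
keeps HasPointwiseScalingLimit (criticalCorr 3) and the NonCoincident normalisation, exactly the
model-specific form the barrier (and Theorems/IsingEuclidUpgradeRefutations.lean) leaves open.
- Literature.Barriers.CriticalPhenomena.LiouvilleRigidity: applies structurally (no planar conformal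
maps in d = 3) and is respected — no conformal map, discrete holomorphicity, SLE or Virasoro is
used; isotropy comes from mirrors + one-variable analyticity, the one symmetry-enhancement line
needing no infinite-dimensional conformal group.
- Literature.Barriers.CriticalPhenomena.BootstrapLatticeBlindness: evaded — the nine RP's are
lattice facts specific to interactions not crossing the mirrors (a next-nearest-neighbour bond
across x₁ = x₂ destroys diagonal site-RP), so the argument is not lattice-blind.
- Literature.Barriers.CriticalPhenomena.LongRangeTrivialityOnZ3 and the in-house interaction-blind
card: the RP long-range anisotropic witnesses (J = g(‖x‖₁)) are reflection positive for the three
COORDINATE mirrors only and their Gaussian limits are singular across {k_i = 0} — precisely the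
loophole the six diagonal mirrors close; the log-perio

Novelty grade: new-mechanism — ROUTE REVIEW (refuter, 2026-08-15). new-mechanism carried from the card audit AND independently supported: I attacked crux (A) HRP2Rigidity at length and proved a fragment instead of refuting it (lit/searchd down rc 75; galaxy 0 hits; prior list = planner's, re-read at mechanism level). ITEMS: 9/9 e (refuter refuter-rreview-route-ABC-TwistAmplifica-3a4d97d5-0, 2026-08-15T14:16:07Z; prior: FrohlichEtAl1978 §3 Thm 3.1 (diagonal site-plane RP, used only for chessboard/infrared bounds), GlimmJaffe1987 Thm 6.2.4 (cone support derived FROM Euclidean invariance), arXiv:1912.07973 §5 / arXiv:2404.05700 §3 (one-direction Stieltjes representation), BergChristensenRessel1984 Thm 4.2.8, JarnickiPflug2011 (cross theorem))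

History (route lifecycle, newest last):
- 2026-08-25T04:34:16Z · DORMANT — reconciler: no traction for 7.4 d (last activity item-evidence-added at 2026-08-17T19:00:39Z); parked, not closed — `ledger route dormant route-CriticalPhenomen (operator:999:2846173)

sub-problem: Ising3DConformalLimit · status: dormant · opened planner-plancard-CriticalPhenomena-Ising3DCon-f19ea08b-0 2026-08-15T11:00:11Z · rev 5 · ledger route-CriticalPhenomena-HyperoctahedralRP
GENERATED by the gate from the ledger (D-0016/17). Provers cite these decls: `theorem foo : Summit.CriticalPhenomena.Ising3DConformalLimit.Theses.HyperoctahedralRP.<Decl> := …` in Summits/CriticalPhenomena/Ising3DConformalLimit/Theorems/<Name>.lean.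
-/

namespace Summit.CriticalPhenomena.Ising3DConformalLimit.Theses.HyperoctahedralRP

open scoped BigOperators Topology Manifold Classical MeasureTheory ProbabilityTheory Matrix InnerProductSpace ComplexConjugate ContinuousMap
open Filter Set Function TopologicalSpace MeasureTheory

attribute [summit_statement] _root_.Ising3DConformalLimit

/-- item stmt-CriticalPhenomena-1979 · crux · rank 2 · closed · proved by Summit.CriticalPhenomena.Ising3DConformalLimit.Cruxes.HRP2Rigidity.XRayMellin.HRP2Rigidity_of @ 34fd3613e614 (prover) · by planner
why it might fail: No theorem turns finitely many reflection positivities into isotropy: RP_n + homogeneity only makes s ↦ K̂(√s·n+q) Stieltjes on nine pencils; an O_h-invariant profile analytic off the 7 rigid great circles may pass all nine — only finite harmonic content, deg ≤ 8 shadows, quadric mixtures excluded.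
sources: BergChristensenRessel1984, FrankLieb2010, FrohlichEtAl1978, GlimmJaffe1987, JarnickiPflug2011, SchillingSongVondracek2012
[crux r2, (A), pure harmonic analysis — the new mechanism] HRP₂ rigidity: a continuous positive
kernel K on ℝ³∖{0}, homogeneous of degree −2Δ with 1/2 ≤ Δ ≤ 1 (the rigorous ℤ³ window,
scalingDimension_mem_Icc_holds), invariant and reflection positive (finite sums over points of the
open half-space ⟨p,n⟩>0, kernel K(p_a − θ_n p_b), θ_n = Submodule.reflection (ℝ∙n)ᗮ) w.r.t. the nine
lattice mirror normals n ∈ {e_i, e_i+e_j, e_i−e_j} (B₃ arrangement), is invariant under every linear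
isometry of ℝ³. Mechanism: RP_n + homogeneity ⇔ s ↦ K̂(√s n + q) Stieltjes
(BergChristensenRessel1984 Thm 4.2.8, §4.4; Widder–Bernstein); at every k ≠ 0 the non-orthogonal
normals span ℝ³ (≤ 4 of the nine lie in any plane) ⇒ cross theorem (JarnickiPflug2011) ⇒ K̂
real-analytic off 0 (LOCAL); GLOBAL: continuation across the de Sitter real forms of the complex
quadric + Nevanlinna growth ⇒ polynomial ⇒ constant (at Δ = 1/2: no spacelike spectral mass ⇒ C(q̂)
≤ C(n) on mirror circles ⇒ B₃ incidences force C ≡ const). Coordinate mirrors alone are insufficient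
(explicit K₁, K₂ on the card; nine-mirror-algebra-test data); finite harmonic content fails even one
mirror; local two-mirror polynomial case proved by h -/
@[route_item "route-CriticalPhenomena-HyperoctahedralRP", crux]
def HRP2Rigidity : Prop :=
  ∀ (Δ : ℝ) (K : EuclideanSpace ℝ (Fin 3) → ℝ), 1/2 ≤ Δ → Δ ≤ 1 → ContinuousOn K {0}ᶜ → (∀ x, x ≠ 0 → 0 < K x) → (∀ c : ℝ, 0 < c → ∀ x, K (c • x) = c ^ (-(2 * Δ)) * K x) → (∀ n : EuclideanSpace ℝ (Fin 3), (∃ i j : Fin 3, i ≠ j ∧ (n = EuclideanSpace.single i 1 ∨ n = EuclideanSpace.single i 1 + EuclideanSpace.single j 1 ∨ n = EuclideanSpace.single i 1 - EuclideanSpace.single j 1)) → (∀ x, K (((ℝ ∙ n)ᗮ).reflection x) = K x) ∧ (∀ (m : ℕ) (p : Fin m → EuclideanSpace ℝ (Fin 3)) (c : Fin m → ℝ), (∀ a, 0 < inner ℝ (p a) n) → 0 ≤ ∑ a, ∑ b, c a * c b * K (p a - ((ℝ ∙ n)ᗮ).reflection (p b)))) → ∀ (R : EuclideanSpace ℝ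 (Fin 3) ≃ₗᵢ[ℝ] EuclideanSpace ℝ (Fin 3)) (x : EuclideanSpace ℝ (Fin 3)), K (R x) = K x

/-- item stmt-CriticalPhenomena-1980 · crux · rank 3 · closed · proved by Summit.CriticalPhenomena.Ising3DConformalLimit.Cruxes.LimitRotationInvariant.QuarterTurnLiouville.LimitRotationInvariant_of @ b509d2f177bd (prover) · by planner
why it might fail: Beyond n = 2 nothing is proved: two-point isotropy does not propagate to S_n, n ≥ 3, and no theorem turns OS positivity in nine time directions + scale covariance into O(3) covariance; on ℤ³ rotation invariance of the limit is a postulate (ICM2022 §8.1 p.25), a theorem only in 2D (arXiv:2012.11672).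
sources: DuminilCopinICM2022, DKKMO2020Rotational, OsterwalderSchrader1973, GlimmJaffe1987, Hasenbusch2021
[crux r3, (B), n-point upgrade given (A)] Assuming HRP2Rigidity: every pointwise scaling limit S of
criticalCorr 3 (ρ > 0 on (0,1]) that is normalised (S = 0 off NonCoincident — the typing fix
demanded by Theorems/IsingEuclidUpgradeRefutations.lean), non-degenerate, translation invariant and
scale covariant with some Δ is IsRotationInvariant (all n, O(3) incl. reflections). Intended proof:
the nine lattice reflection positivities (CriticalCorrNineMirrorRP) pass to the limit as OS
positivity of {S_n} in nine 'time' directions; n = 2 is (A) via TwoPointKernelOfLimit; n ≥ 3 by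
analytic continuation of S_n in nine families of time variables + scale covariance + B₃ (alternative
engine: modular/boost covariance, card rotations-are-boosts-modular). Rotation invariance on ℤ³ is
only postulated (DuminilCopinICM2022 §8.1 p.25); planar analogue arXiv:2012.11672. -/
@[route_item "route-CriticalPhenomena-HyperoctahedralRP", crux]
def LimitRotationInvariant : Prop :=
  HRP2Rigidity → ∀ (ρ : ℝ → ℝ) (Δ : ℝ) (S : Literature.Probability.LatticeModels.CorrFamily 3), (∀ δ ∈ Set.Ioc (0:ℝ) 1, 0 < ρ δ) → Literature.Probability.LatticeModels.HasPointwiseScalingLimit (Literature.Probability.LatticeModels.criticalCorr 3) ρ S → (∀ n z, z ∉ Literature.Probability.LatticeModels.NonCoincident 3 n → S n z = 0) → Literature.Probability.LatticeModels.IsNondegenerateTwoPoint S → Literature.Probability.LatticeModels.IsTranslationInvariant S → Literature.Probability.LatticeModels.IsScaleCovariant Δ S → Literature.Probability.LatticeModels.IsRotationInvariant S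

/-- item stmt-CriticalPhenomena-1981 · crux · rank 4 · open · by planner
why it might fail: Existence of the full δ→0⁺ limit of all n-point functions with one continuous Δ > 0 is the open problem on ℤ³ (ICM2022 §8.4 p.29, 'widely open'): c|x|⁻² ≤ G ≤ C|x|⁻¹ (ADS2015, DC–Panis) gives only subsequential limits, Δ ∈ [1/2,1]; no uniqueness / exact scale-covariance mechanism known in d = 3.
sources: DuminilCopinICM2022, DuminilcopinPanis2025, AizenmanDuminilCopinSidoravicius2015, AizenmanDuminilCopinAnnals2021
[crux r4, (C), existence WITHOUT rotations] There are ρ > 0 on (0,1], Δ > 0 and S with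
HasPointwiseScalingLimit (criticalCorr 3) ρ S, S = 0 off NonCoincident, IsNondegenerateTwoPoint S,
IsTranslationInvariant S, IsScaleCovariant Δ S. Strictly weaker than CritIsing3DEuclideanLimit (item
0638: rotations included) — on this route isotropy is OUTPUT. Inputs in tree:
criticalTwoPoint_bounds_holds (c|x|⁻² ≤ G ≤ C|x|⁻¹ ⇒ subsequential limits, Δ ∈ [1/2,1]); missing:
uniqueness/full-filter convergence and continuous scale covariance (DuminilCopinICM2022 §8.4 p.29:
'widely open'). -/
@[route_item "route-CriticalPhenomena-HyperoctahedralRP", crux]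
def ExistsScaleCovariantLimit : Prop :=
  ∃ (ρ : ℝ → ℝ) (Δ : ℝ) (S : Literature.Probability.LatticeModels.CorrFamily 3), (∀ δ ∈ Set.Ioc (0:ℝ) 1, 0 < ρ δ) ∧ 0 < Δ ∧ Literature.Probability.LatticeModels.HasPointwiseScalingLimit (Literature.Probability.LatticeModels.criticalCorr 3) ρ S ∧ (∀ n z, z ∉ Literature.Probability.LatticeModels.NonCoincident 3 n → S n z = 0) ∧ Literature.Probability.LatticeModels.IsNondegenerateTwoPoint S ∧ Literature.Probability.LatticeModels.IsTranslationInvariant S ∧ Literature.Probability.LatticeModels.IsScaleCovariant Δ S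

/-- item stmt-CriticalPhenomena-1982 · crux · rank 5 · open · by planner
why it might fail: Scale + Euclid (+ RP) ⇏ inversion covariance in general (free Maxwell d = 3, ElshowkNakayamaRychkov2011; witnessFamily of ScaleCovarianceNotMoebius); for Ising it rests on absence of a Δ = 2 virial current, backed only by non-rigorous RG (DTW2016 §5–6) and Monte-Carlo Δ_V > 5 (MenesesEtAl2019).
sources: ElshowkNakayamaRychkov2011, Nakayama2015, DelamotteTissierWschebor2016, MenesesEtAl2019, PolandRychkovVichi2019, Literature.Barriers.CriticalPhenomena.ScaleCovarianceNotMoebius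
[crux r5, (D), inversion upgrade re-typed] Every pointwise scaling limit S of criticalCorr 3 (ρ > 0
on (0,1]) that is normalised (S = 0 off NonCoincident), non-degenerate, Euclidean invariant and
scale covariant with Δ is IsInversionCovariant Δ (hence Möbius). This is (U) of route
IsingEuclidUpgrade (item 0637, refuted AS TYPED by not_inversionUpgrade_of_euclideanLimit through
values on the coincident locus) with the normalisation hypothesis the refutation file prescribes;
the model-blind version is false (Literature.Barriers.CriticalPhenomena.ScaleCovarianceNotMoebius;
free Maxwell d=3, ElshowkNakayamaRychkov2011), so any proof must use the Ising hypothesis (RP +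
locality / absence of a dimension-2 virial current: DelamotteTissierWschebor2016 §5–6,
Nakayama2015). -/
@[route_item "route-CriticalPhenomena-HyperoctahedralRP", crux]
def InversionUpgradeNormalised : Prop :=
  ∀ (ρ : ℝ → ℝ) (Δ : ℝ) (S : Literature.Probability.LatticeModels.CorrFamily 3), (∀ δ ∈ Set.Ioc (0:ℝ) 1, 0 < ρ δ) → Literature.Probability.LatticeModels.HasPointwiseScalingLimit (Literature.Probability.LatticeModels.criticalCorr 3) ρ S → (∀ n z, z ∉ Literature.Probability.LatticeModels.NonCoincident 3 n → S n z = 0) → Literature.Probability.LatticeModels.IsNondegenerateTwoPoint S → Literature.Probability.LatticeModels.IsEuclideanInvariant S → Literature.Probability.LatticeModels.IsScaleCovariant Δ S → Literature.Probability.LatticeModels.IsInversionCovariant Δ S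

/-- item stmt-CriticalPhenomena-0636 · crux · rank 6 · open · by planner
why it might fail: Non-triviality in d = 3 is open: U₄ ≢ 0 needs the double-current intersection probability at macroscopic separation to stay > 0 as δ → 0 (Aizenman1982); theorems in print go the other way — Gaussian limits for n.n. d = 4 (ADC2021) and RP long-range models on ℤ³, α ≤ 3/2 (Panis2023 Thm 1.2/Cor 1.11).
sources: AizenmanDuminilCopinAnnals2021, Panis2023Triviality, Aizenman1982, DuminilCopinICM2022, Literature.Barriers.CriticalPhenomena.LongRangeTrivialityOnZ3
Crux r4 (non-triviality in d=3): every non-degenerate pointwise scaling limit S of the renormalised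
critical Ising correlators on Z^3 has connected four-point function U4 ≢ 0 on non-coincident
configurations. Intended tool: the random-current identity U4(x,y,z,t) =
−2⟨σxσy⟩⟨σzσt⟩·P^{xy,zt}[C_{n1+n2}(x) ∩ C_{n1+n2}(z) ≠ ∅] (Aizenman 1982; ADC2021 arXiv:1912.07973
eq. (3.11)): non-Gaussianity ⇔ the intersection probability of the two double-current clusters at
macroscopic separation does not vanish as δ → 0. Contrast: for d ≥ 4 every such limit IS Gaussian
(Literature.Probability.LatticeModels.highDim_triviality). Its negation refutes the conjunct
Ising3DConformalLimit itself. -/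
@[route_item "route-CriticalPhenomena-HyperoctahedralRP", crux]
def IsingEuclidUpgradeR4NonGaussian : Prop :=
  ∀ (ρ : ℝ → ℝ) (S : Literature.Probability.LatticeModels.CorrFamily 3), (∀ δ ∈ Set.Ioc (0:ℝ) 1, 0 < ρ δ) → Literature.Probability.LatticeModels.HasPointwiseScalingLimit (Literature.Probability.LatticeModels.criticalCorr 3) ρ S → Literature.Probability.LatticeModels.IsNondegenerateTwoPoint S → Literature.Probability.LatticeModels.HasNontrivialU4 S

/-- item stmt-CriticalPhenomena-1983 · support · rank 9 · closed · proved by Summit.CriticalPhenomena.Ising3DConformalLimit.HyperoctahedralRPTwoPoint.twoPointKernelOfLimit_proof (prover) · by planner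
sources: MessagerMiracleSoleJSP1977, FrohlichEtAl1978, DuminilcopinPanis2025
[support, glue for (A) at n = 2] For every pointwise scaling limit S of criticalCorr 3 (ρ > 0 on
(0,1]) that is non-degenerate, translation invariant and scale covariant with Δ, the kernel K x := S
2 ![0, x] satisfies the hypotheses of HRP2Rigidity: 1/2 ≤ Δ ≤ 1 (scalingDimension_mem_Icc_holds),
ContinuousOn K {0}ᶜ (Messager–Miracle-Solé axis + diagonal monotonicity, messager_miracleSole_holds
/ _diag_holds, pass to the limit; with homogeneity and evenness they sandwich K near every x ≠ 0), K
> 0 off 0, K(c•x) = c^(−2Δ) K x, invariance under the nine lattice mirrors (lattice symmetry +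
continuity) and nine-mirror reflection positivity of the finite sums (CriticalCorrNineMirrorRP +
translation invariance + symmetry of S 2). -/
@[route_item "route-CriticalPhenomena-HyperoctahedralRP", crux]
def TwoPointKernelOfLimit : Prop :=
  ∀ (ρ : ℝ → ℝ) (Δ : ℝ) (S : Literature.Probability.LatticeModels.CorrFamily 3), (∀ δ ∈ Set.Ioc (0:ℝ) 1, 0 < ρ δ) → Literature.Probability.LatticeModels.HasPointwiseScalingLimit (Literature.Probability.LatticeModels.criticalCorr 3) ρ S → Literature.Probability.LatticeModels.IsNondegenerateTwoPoint S → Literature.Probability.LatticeModels.IsTranslationInvariant S → Literature.Probability.LatticeModels.IsScaleCovariant Δ S → (1/2 ≤ Δ ∧ Δ ≤ 1) ∧ ContinuousOn (fun x : EuclideanSpace ℝ (Fin 3) => S 2 ![0, x]) {0}ᶜ ∧ (∀ x : EuclideanSpace ℝ (Fin 3), x ≠ 0 → 0 < S 2 ![0, x]) ∧ (∀ c : ℝ, 0 < c → ∀ x : EuclideanSpace ℝ (Fin 3), S 2 ![0, c • x] = c ^ (-(2 * Δ)) * S 2 ![0, x]) ∧ (∀ n : EuclideanSpace ℝ (Fin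 3), (∃ i j : Fin 3, i ≠ j ∧ (n = EuclideanSpace.single i 1 ∨ n = EuclideanSpace.single i 1 + EuclideanSpace.single j 1 ∨ n = EuclideanSpace.single i 1 - EuclideanSpace.single j 1)) → (∀ x : EuclideanSpace ℝ (Fin 3), S 2 ![0, ((ℝ ∙ n)ᗮ).reflection x] = S 2 ![0, x]) ∧ (∀ (m : ℕ) (p : Fin m → EuclideanSpace ℝ (Fin 3)) (c : Fin m → ℝ), (∀ a, 0 < inner ℝ (p a) n) → 0 ≤ ∑ a, ∑ b, c a * c b * S 2 ![0, p a - ((ℝ ∙ n)ᗮ).reflection (p b)]))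

/-- item stmt-CriticalPhenomena-1984 · support · rank 9 · closed · proved by Summit.CriticalPhenomena.Ising3DConformalLimit.HyperoctahedralRPTwoPoint.twoPointLimitIsotropic_proof @ da1ff21bfe3a (prover) · by planner
sources: DuminilCopinICM2022, 2012.11672
[support, milestone = HRP2Rigidity ∘ TwoPointKernelOfLimit] Two-point isotropy of the critical ℤ³
Ising scaling limit: for every non-degenerate, translation-invariant, scale-covariant pointwise
limit S of criticalCorr 3, S 2 ![0, R x] = S 2 ![0, x] for all linear isometries R and x ≠ 0. The
continuum form of the rotational half of item 0634 (IsingEuclidUpgradeR2RotInvPowerLaw asks it on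
the lattice with a pure power law); open on ℤ³ (DuminilCopinICM2022 §8.1). -/
@[route_item "route-CriticalPhenomena-HyperoctahedralRP", crux]
def TwoPointLimitIsotropic : Prop :=
  ∀ (ρ : ℝ → ℝ) (Δ : ℝ) (S : Literature.Probability.LatticeModels.CorrFamily 3), (∀ δ ∈ Set.Ioc (0:ℝ) 1, 0 < ρ δ) → Literature.Probability.LatticeModels.HasPointwiseScalingLimit (Literature.Probability.LatticeModels.criticalCorr 3) ρ S → Literature.Probability.LatticeModels.IsNondegenerateTwoPoint S → Literature.Probability.LatticeModels.IsTranslationInvariant S → Literature.Probability.LatticeModels.IsScaleCovariant Δ S → ∀ (R : EuclideanSpace ℝ (Fin 3) ≃ₗᵢ[ℝ] EuclideanSpace ℝ (Fin 3)) (x : EuclideanSpace ℝ (Fin 3)), x ≠ 0 → S 2 ![0, R x] = S 2 ![0, x]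

/-- item stmt-CriticalPhenomena-1985 · support · rank 9 · closed · proved by Summit.CriticalPhenomena.Ising3DConformalLimit.HyperoctahedralRPNineMirror.criticalCorrNineMirrorRP_proof (prover) · by planner
sources: FrohlichEtAl1978, FriedliVelenik2017
[support, lattice input, FILS 1978] Nine-mirror reflection positivity of the critical plus-state
correlators on ℤ³: for each site mirror through the origin — coordinate plane x_i = 0 (θ negates
x_i, ℓ = x_i), diagonal plane x_i = x_j (θ swaps, ℓ = x_i − x_j), anti-diagonal x_i = −x_j (θ: x_i ↦
−x_j, x_j ↦ −x_i, ℓ = x_i + x_j) — and finitely many lattice configurations x^a strictly inside {ℓ >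
0} with real coefficients c_a: Σ_ab c_a c_b criticalCorr 3 (k_a + k_b) (Fin.append (θ ∘ x^a) x^b) ≥
0, i.e. ⟨ΘF·F⟩⁺_{β_c} ≥ 0. From the proved tree lemma isingMeasure_univ_free_reflectionPositive (any
involutive graph automorphism with every n.n. edge inside P or θP — true for the swap since a bond
changes x_i − x_j by ±1 and never crosses strictly) on symmetric boxes with + boundary field
(θ-symmetric), hasBoxLimit_isingCorr_plus_holds, and closedness of RP under limits; FrohlichEtAl1978
§3 Thm 3.1 (planes through sites), FriedliVelenik2017 Lemma 10.8. -/
@[route_item "route-CriticalPhenomena-HyperoctahedralRP", crux]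
def CriticalCorrNineMirrorRP : Prop :=
  ∀ (θ : Literature.Probability.LatticeModels.Site 3 → Literature.Probability.LatticeModels.Site 3) (ℓ : Literature.Probability.LatticeModels.Site 3 → ℤ), (∃ i j : Fin 3, i ≠ j ∧ ((θ = fun x => Function.update x i (-x i)) ∧ (ℓ = fun x => x i) ∨ (θ = fun x => x ∘ Equiv.swap i j) ∧ (ℓ = fun x => x i - x j) ∨ (θ = fun x => Function.update (Function.update x i (-x j)) j (-x i)) ∧ (ℓ = fun x => x i + x j))) → ∀ (m : ℕ) (k : Fin m → ℕ) (x : (a : Fin m) → Fin (k a) → Literature.Probability.LatticeModels.Site 3) (c : Fin m → ℝ), (∀ a i, 0 < ℓ (x a i)) → 0 ≤ ∑ a, ∑ b, c a * c b * Literature.Probability.LatticeModels.criticalCorr 3 (k a + k b) (Fin.append (fun i => θ (x a i)) (x b))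

/-- item stmt-CriticalPhenomena-4275 · support · rank 9 · closed · proved by Summit.CriticalPhenomena.Ising3DConformalLimit.Theorems.nullConeLocalRigidity_proof (prover) · by planner
[support · card hrp-null-cone-root-splitting · local null-cone root-splitting rigidity = the
polynomial shadow of crux r2 HRP2Rigidity near the round kernel; ONE diagonal mirror suffices] Let Q
be a real form of degree 2m on ℝ³ invariant under the hyperoctahedral group O_h (coordinate
permutations + sign changes: rename/aeval hypotheses). If for a real sequence ε_n → 0, ε_n ≠ 0,
every pencil member P_n = (k·k)^m + ε_n Q passes the ROOT TEST of reflection positivity in the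
diagonal mirror x₁ = x₂ — for every k⊥ = (a,−a,b) ≠ 0 all complex roots t of t ↦ P_n(k⊥ + t(e₁+e₂))
= P_n(a+t, −a+t, b) are purely imaginary (⇔ s = t² real ≤ 0, i.e. s ↦ P_n(k⊥+√s·u) is zero-free off
(−∞,0], the necessary condition for s ↦ P_n^{−γ} to be Stieltjes = RP of the kernel in direction u;
cards nine-mirror-algebra-test, hyperoctahedral-rp-rigidity) — then Q = c·(k·k)^m. PROOF (card
(R1)–(R2), sharpened by the planner: the coordinate mirror is not needed, and no Rouché is needed):
Q is even under the swap, so on the fibre P_n = (c+σ)^M + ε q(σ) with σ ∝ t², c = |k⊥|² > 0, M =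
current degree/2. Level M ≥ 3: if all roots σ_i are real, put δ_i = c+σ_i; Vieta gives Σδ_i = O(ε),
Σ_{i<j}δ_iδ_j = O(ε), ∏δ_i = ∓ε -/
@[route_item "route-CriticalPhenomena-HyperoctahedralRP", crux]
def NullConeLocalRigidity : Prop :=
  ∀ (m : ℕ) (Q : MvPolynomial (Fin 3) ℝ), Q.IsHomogeneous (2 * m) → (∀ σ : Equiv.Perm (Fin 3), MvPolynomial.rename σ Q = Q) → (∀ i : Fin 3, MvPolynomial.aeval (fun j : Fin 3 => if j = i then -(MvPolynomial.X j) else MvPolynomial.X j) Q = Q) → (∃ ε : ℕ → ℝ, Filter.Tendsto ε Filter.atTop (𝓝[≠] (0 : ℝ)) ∧ ∀ (n : ℕ) (a b : ℝ) (t : ℂ), (a ≠ 0 ∨ b ≠ 0) → MvPolynomial.eval₂ (algebraMap ℝ ℂ) ![(a : ℂ) + t, -(a : ℂ) + t, (b : ℂ)] ((MvPolynomial.X 0 ^ 2 + MvPolynomial.X 1 ^ 2 + MvPolynomial.X 2 ^ 2) ^ m + MvPolynomial.C (ε n) * Q) = 0 → t.re = 0) → ∃ c : ℝ, Q = MvPolynomial.C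 c * (MvPolynomial.X 0 ^ 2 + MvPolynomial.X 1 ^ 2 + MvPolynomial.X 2 ^ 2) ^ m

/-- item stmt-CriticalPhenomena-1986 · assembly · rank 1 · closed · proved by Summit.CriticalPhenomena.Ising3DConformalLimit.Theorems.hyperoctahedralRP_assembly_proof @ 20a055b94c44 (prover) · by planner
sources: DuminilCopinICM2022
[assembly] HRP2Rigidity → LimitRotationInvariant → ExistsScaleCovariantLimit →
InversionUpgradeNormalised → IsingEuclidUpgradeR4NonGaussian → Ising3DConformalLimit. Proof (checked
in the planner's Sketch.lean): take ρ, Δ, S from (C); (B) (A) gives IsRotationInvariant S, so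
IsEuclideanInvariant S := ⟨transl, rot⟩; (D) gives IsInversionCovariant Δ S; IsMoebiusCovariant Δ S
:= ⟨Euclid, scale, inversion⟩; (E) gives HasNontrivialU4 S; conclude CritIsing3DConformalLimit. -/
@[route_item "route-CriticalPhenomena-HyperoctahedralRP", crux]
def Assembly : Prop :=
  HRP2Rigidity → LimitRotationInvariant → ExistsScaleCovariantLimit → InversionUpgradeNormalised → IsingEuclidUpgradeR4NonGaussian → Ising3DConformalLimit

/-! D-0027 §2.1 — DECIDING THEOREM (planner-authored via `route open/edit --closes-file`; by operator:999:2941348 2026-08-15T15:23:11Z):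
its hypotheses are this route's items and its conclusion the sub-problem Statement (glue_lint), and it elaborates with this file. -/

@[closes "route-CriticalPhenomena-HyperoctahedralRP"] theorem closes : HRP2Rigidity → LimitRotationInvariant → ExistsScaleCovariantLimit → InversionUpgradeNormalised → IsingEuclidUpgradeR4NonGaussian → TwoPointKernelOfLimit → TwoPointLimitIsotropic → CriticalCorrNineMirrorRP → NullConeLocalRigidity → Assembly → _root_.Ising3DConformalLimit := fun h_HRP2Rigidity h_LimitRotationInvariant h_ExistsScaleCovariantLimit h_InversionUpgradeNormalised h_IsingEuclidUpgradeR4NonGaussian h_TwoPointKernelOfLimit h_TwoPointLimitIsotropic h_CriticalCorrNineMirrorRP h_NullConeLocalRigidity h_Assembly => h_Assembly h_HRP2Rigidity h_LimitRotationInvariant h_ExistsScaleCovariantLimit h_InversionUpgradeNormalised h_IsingEuclidUpgradeR4NonGaussian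

end Summit.CriticalPhenomena.Ising3DConformalLimit.Theses.HyperoctahedralRP
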